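import Literature.Geometry.Kaehler.ComplexTorusAbelianThreefoldImaginaryQuadraticHodgeEqLefschetz
import Literature.Geometry.Kaehler.ComplexTorusLieAlgebraIdealSemisimpleDefinedOverQ
import Literature.Geometry.Kaehler.ComplexTorusHodgeGroupProductAlmostQSimpleAbelianVariety
import Literature.Geometry.Kaehler.ComplexTorusSimpleCMSurfaceHodgeGroupAlmostQSimple
import Literature.Geometry.Kaehler.ComplexTorusSimpleAbelianThreefoldHodgeGroupDimension
import Literature.Algebra.Lie.CentralSimpleDerivedLieAlgebra
import HarnessLib

/-!
# Moonen–Zarhin 1999 (2.3) Type IV(1,1) and §5 (5.8): the derived Hodge Lie algebra `𝒟𝒜(T)` of a simple abelian threefold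
# with imaginary quadratic multiplication is `ℚ`-SIMPLE (a `ℚ`-form of `𝔰𝔩₃`: `𝔤 = Lie Hg(T)(ℂ) ≅ 𝔤𝔩(V_σ)`, `𝒟𝔤 ≅ 𝔰𝔩₃`);
# hence Lemma (3.4)∕(3.5) splits `T × S` for every polarised `S` whose Hodge Lie algebra `𝒜(S)` is `ℚ`-simple of dimension `< 8`

Layer `Literature/Geometry/Kaehler`, namespace `Literature.Geometry.Kaehler.ComplexTorus`; lane `lit-hodgefound` (Track 2
foundations library), Layer A3∕A4; prover seat `lit-hodgefound-p17`, generation 55, self-proposed row g55-#7 (towards the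
residual sub-case «`T` of type IV(1,1) × `S` of type I(2) ∕ II(1)» of ✔ g55-#5∕#6).  THEOREMS ONLY (no definition, no
instance, no notation, no named fact; D-0026 net debt `0`).

## Sources, VERBATIM (held `paper:arxiv-math_9901113`; locators are page ∕ line of the materialisation)

B. J. J. Moonen, Yu. G. Zarhin [MoonenZarhin1999LowDim], Math. Ann. **315** (1999):
* §2 (2.3) `g = 3` (p0005 L101–L103): «Type IV(1,1): `End⁰(X) = F` is an imaginary quadratic field; … `Hg(X) = U_F(V,ψ)`»;
  proof of (2.4)(1) (p0005 L126–L131): «`Hg(X)_ℝ` is a unitary group of signature `(2,1)`».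
* §3 Lemma (3.4) (p0006 L133 – p0007 L8; arXiv numbering (3.5)): «Assume that `𝔥𝔤(X₂)` is a `ℚ`-simple Lie algebra of
  non-compact type … Then either `Hg(X) = Hg(X₁) × Hg(X₂)` or `Hom(X₂,X₁) ≠ 0`», proof: «we obtain an isomorphism
  `𝔥𝔤(X₂) ⥲ 𝔤₃`»; §5 (5.8) (p0010 L3–L9): «Suppose `(d₁,d₂) = (2,3)`. If `X₁` is simple then Lemma (3.4) gives
  `Hg(X) = Hg(X₁) × Hg(X₂)`.»
* J. S. Milne [Milne1999LefschetzClasses], §2 Remark 2.2 («The map `α ↦ α|V₁ : U(φ₀)_Ω → GL(V₁)` is an isomorphism»),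
  Summary p. 652 («IV ∣ GL»).
* N. Jacobson [Jacobson1962LieAlgebras], *Lie Algebras*, Ch. X §3 Theorem 8 (p. 304): the derived algebra of a central
  simple associative algebra `𝔄 ≠ Γ` is a (central) simple Lie algebra of type `A_l` — the tree's
  `CentralSimpleDerivedLieAlgebra.isSimple_derived` (`Γ = ℂ`, `𝔄 = M₃(ℂ)`: `𝒟𝔤𝔩₃ = 𝔰𝔩₃` is simple).
* N. Bourbaki [Bourbaki1989LieGroups13], Ch. I §6 no. 10 (simplicity and extension of scalars) — the tree's descent
  `isSimple_derivedSeries_hodgeGroupLieRat_of_hodgeGroupComplexLie` (`𝒟𝔤` simple ⟹ `𝒟𝒜` simple).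

## What is proved, and how

* §1 **`IsSimple.isSimple_derivedSeries_hodgeGroupComplexLie_of_finrank_eq_two_of_finrank_eq_three`** — for a SIMPLE
  polarised threefold `T` with `End⁰(T) = f(K)`, `[K : ℚ] = 2` a CM field: `𝒟𝔤`, `𝔤 = Lie Hg(T)(ℂ)`, is a SIMPLE complex
  Lie algebra.  PROOF: the restriction `ρ : 𝔤 → 𝔤𝔩(V_σ)`, `Z ↦ Z|V_σ`, is a Lie homomorphism (`V_σ` is `𝔤`-stable),
  SURJECTIVE by g50-#6 («`𝔤|V_σ = 𝔤𝔩(V_σ)`», Kostant at `n = 3`) and INJECTIVE by g50-#6 §1 (an `E`-skew matrix preserving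
  `V_σ̄` and killing `V_σ` kills `V_σ̄`; `V_ℂ = V_σ + V_σ̄`) — «`α ↦ α|V₁` is an isomorphism»; so `𝔤 ≅ 𝔤𝔩(V_σ) ≅ M₃(ℂ)_L`
  and `𝒟𝔤 ≅ 𝒟 M₃(ℂ)_L`, simple by Jacobson's Theorem 8.  Then
  **`IsSimple.isSimple_derivedSeries_hodgeGroupLieRat_of_finrank_eq_two_of_finrank_eq_three`** (`𝒟𝒜(T)` is `ℚ`-simple,
  Bourbaki descent) and the intrinsic forms `…_of_finrank_centerField_eq_two_of_finrank_eq_three` (`[Z(End⁰ T) : ℚ] = 2`),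
  with `dim_ℚ 𝒟𝒜(T) ≥ 8` (`dim 𝒜(T) = 9`, `dim 𝔷(𝒜(T)) < 2`).
* §2 LEMMA (3.4) APPLIED: **`IsSimple.hodgeGroupC_prod_eq_blockDiagProd_of_finrank_centerField_eq_two_of_isSimple_hodgeGroupLieRat_of_finrank_lt`**
  — `T` of type IV(1,1), `S` polarised with `𝒜(S)` `ℚ`-simple and `dim_ℚ 𝒜(S) < 8` ⟹ `Hg(T × S)(ℂ) = Hg(T)(ℂ) × Hg(S)(ℂ)`:
  by the tree's combined Lemma (3.4)∕(3.6) (`…AlmostQSimpleAbelianVariety`; `(hQ)` for `S` from `𝒜(S)` simple), non-split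
  gives `𝒜(S)` abelian (impossible) or a surjection `𝒟𝒜(T) ↠ 𝒜(S)`, injective since `𝒟𝒜(T)` is simple and `𝒜(S) ≠ 0` —
  «an isomorphism `𝔥𝔤(X₂) ⥲ 𝔤₃`» — so `dim 𝒜(S) = dim 𝒟𝒜(T) ≥ 8`, contradiction; real points and the (D)-transfer
  `IsSimple.forall_divisorClasses_powPeriod_prod_eq_hodgeClasses_of_finrank_centerField_eq_two_of_isSimple_hodgeGroupLieRat_of_finrank_lt`
  (given (D) for `S`).  The remaining input for (5.8) — `𝒜(S)` is `ℚ`-simple for a simple surface of type I(2) ∕ II(1) — is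
  NOT in this file (-- TODO(general form): next row).
-/

noncomputable section

open Matrix Module Function NumberField LieAlgebra

open scoped MatrixGroups

namespace Literature.Geometry.Kaehler

namespace ComplexTorus

open Literature.Algebra.Lie (SimpleBaseChange.isSimple_of_lieEquiv CentralSimpleDerivedLieAlgebra.isSimple_derived)

/-! ### §0 Plumbing (file-local) -/

section Plumbing

/-- **Isomorphic Lie algebras have simultaneously simple derived algebras** (`e` carries `𝒟L` onto `𝒟L'`). [folklore]
[cite: Bourbaki1989LieGroups13, Ch. I §1 no. 5 Prop. 4] -/
private theorem isSimple_derivedSeries_of_lieEquiv₅₇ {R L L' : Type*} [CommRing R] [LieRing L] [LieAlgebra R L] [LieRing L']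
    [LieAlgebra R L'] (e : L ≃ₗ⁅R⁆ L') [LieAlgebra.IsSimple R (derivedSeries R L' 1)] :
    LieAlgebra.IsSimple R (derivedSeries R L 1) := by
  have hmap : (derivedSeries R L 1).map (e : L →ₗ⁅R⁆ L') = derivedSeries R L' 1 :=
    LieIdeal.derivedSeries_map_eq 1 e.surjective
  have h : ((derivedSeries R L 1 : LieIdeal R L) : LieSubalgebra R L).map (e : L →ₗ⁅R⁆ L') =
      ((derivedSeries R L' 1 : LieIdeal R L') : LieSubalgebra R L') := by
    apply LieSubalgebra.toSubmodule_injective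
    ext x
    rw [LieIdeal.toLieSubalgebra_toSubmodule, ← hmap, LieIdeal.coe_map_of_surjective e.surjective]
    exact Iff.rfl
  haveI : LieAlgebra.IsSimple R ↥((derivedSeries R L' 1 : LieIdeal R L') : LieSubalgebra R L') := ‹_›
  have h' : LieAlgebra.IsSimple R ↥((derivedSeries R L 1 : LieIdeal R L) : LieSubalgebra R L) :=
    SimpleBaseChange.isSimple_of_lieEquiv (LieEquiv.ofSubalgebras _ _ e h)
  exact h'

variable {ι : Type*} [Fintype ι] [DecidableEq ι] {K : Type*} [Field K] [NumberField K] (f : K →ₐ[ℚ] Matrix ι ι ℚ)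

/-- The two complex embeddings of a quadratic field with a non-real embedding `σ` are `σ` and `σ̄`. [folklore] -/
private theorem eq_or_eq_conjugate_of_finrank_eq_two₅₇ (hK : finrank ℚ K = 2) {σ : K →+* ℂ}
    (hσ : ComplexEmbedding.conjugate σ ≠ σ) (τ : K →+* ℂ) : τ = σ ∨ τ = ComplexEmbedding.conjugate σ := by
  classical
  by_contra h
  push Not at h
  have hcard : Fintype.card (K →+* ℂ) = 2 := by rw [NumberField.Embeddings.card, hK]
  have h3 : ({σ, ComplexEmbedding.conjugate σ, τ} : Finset (K →+* ℂ)).card = 3 := by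
    rw [Finset.card_insert_of_notMem (by simp [hσ.symm, Ne.symm h.1]),
      Finset.card_insert_of_notMem (by simp [Ne.symm h.2]), Finset.card_singleton]
  have hle := Finset.card_le_univ ({σ, ComplexEmbedding.conjugate σ, τ} : Finset (K →+* ℂ))
  omega

/-- `V_ℂ = V_σ + V_σ̄` for a quadratic field and a non-real `σ`. [folklore] [cite: MoonenZarhin1998WeilClasses, §3 (3)] -/
private theorem sup_iInf_eigenspace_conjugate_eq_top₅₇ (hK : finrank ℚ K = 2) {σ : K →+* ℂ}
    (hσ : ComplexEmbedding.conjugate σ ≠ σ) :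
    (⨅ a : K, Module.End.eigenspace (Matrix.toLin' ((f a).map (algebraMap ℚ ℂ))) (σ a)) ⊔
      (⨅ a : K, Module.End.eigenspace (Matrix.toLin' ((f a).map (algebraMap ℚ ℂ)))
        (ComplexEmbedding.conjugate σ a)) = ⊤ := by
  rw [eq_top_iff, ← iSup_iInf_eigenspace_toLin'_map_eq_top f]
  refine iSup_le fun τ ↦ ?_
  rcases eq_or_eq_conjugate_of_finrank_eq_two₅₇ hK hσ τ with rfl | rfl
  · exact le_sup_left
  · exact le_sup_right

end Plumbing

/-! ## §1 `𝒟𝔤 ≅ 𝔰𝔩₃` is simple; `𝒟𝒜(T)` is `ℚ`-simple -/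

section Derived

variable {ι : Type} [Fintype ι] [DecidableEq ι] {E : Type} [NormedAddCommGroup E] [NormedSpace ℂ E]
  [FiniteDimensional ℂ E] {Φ : (ι → ℝ) ≃L[ℝ] E} {η : E [⋀^Fin 2]→L[ℝ] ℝ} {K : Type} [Field K] [NumberField K]
  [IsCMField K]

/-- **`𝒟𝔤` IS SIMPLE FOR A SIMPLE THREEFOLD WITH IMAGINARY QUADRATIC MULTIPLICATION** (`𝔤 = Lie Hg(T)(ℂ) ≅ 𝔤𝔩(V_σ) ≅ 𝔤𝔩₃`,
«`α ↦ α|V₁ : U(φ₀)_Ω → GL(V₁)` is an isomorphism», and `𝒟𝔤𝔩₃ = 𝔰𝔩₃` is simple): for a simple polarised complex torus of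
dimension `3` with `End⁰(T) = f(K)`, `K` a CM field of degree `2`, the derived algebra of `hodgeGroupComplexLie` is a simple
complex Lie algebra. [cite: MoonenZarhin1999LowDim, §2 (2.3) `g = 3` Type IV(1,1) (p0005 L101–L103) and proof of (2.4)(1)]
[cite: Milne1999LefschetzClasses, §2 Remark 2.2] [cite: Jacobson1962LieAlgebras, Ch. X §3 Theorem 8 (p. 304)] -/
theorem IsSimple.isSimple_derivedSeries_hodgeGroupComplexLie_of_finrank_eq_two_of_finrank_eq_three (hX : IsSimple Φ)
    (hη : IsRiemannForm Φ η) (hK : finrank ℚ K = 2) (hE : finrank ℂ E = 3) (f : K →ₐ[ℚ] Matrix ι ι ℚ)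
    (hfE : f.range = endAlgRat Φ) : LieAlgebra.IsSimple ℂ (derivedSeries ℂ (hodgeGroupComplexLie Φ) 1) := by
  classical
  letI : LieRing (Matrix ι ι ℂ) := LieRing.ofAssociativeRing
  letI : LieAlgebra ℂ (Matrix ι ι ℂ) := LieAlgebra.ofAssociativeAlgebra
  have hfE' : ∀ y, f y ∈ endAlgRat Φ := fun y ↦ by rw [← hfE]; exact AlgHom.mem_range_self f y
  have hcard : Fintype.card ι = 6 := by rw [card_eq_two_mul_finrank Φ, hE]
  haveI : Nonempty ι := Fintype.card_pos_iff.1 (by omega)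
  obtain ⟨G, hGη⟩ := hη.exists_ratMatrix_latticeGram
  -- an embedding `σ`; `σ̄ ≠ σ`; `V_ℂ = V_σ + V_σ̄`; `ᵗ(f a) G = G f(ā)`
  obtain ⟨σ⟩ : Nonempty (K →+* ℂ) := by
    have h : 0 < Fintype.card (K →+* ℂ) := by rw [NumberField.Embeddings.card, hK]; norm_num
    exact Fintype.card_pos_iff.1 h
  have hσ : ComplexEmbedding.conjugate σ ≠ σ := fun h ↦
    IsTotallyComplex.complexEmbedding_not_isReal σ (ComplexEmbedding.isReal_iff.2 h)
  have hsup := sup_iInf_eigenspace_conjugate_eq_top₅₇ f hK hσ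
  have hGu : IsUnit G.det := isUnit_det_of_map_ratCast hGη hη.isUnit_det_latticeGram
  have hsym : ∀ a : K, (f a)ᵀ * G = G * f (IsCMField.complexConj K a) := fun a ↦
    (rosati_eq_iff hGu (f a) _).1 (rosati_eq_complexConj_of_range_eq_endAlgRat Φ hη.1 hη.2.2 hGη f hfE a)
  -- `W = V_σ`, `dim W = 3`
  set W : Submodule ℂ (ι → ℂ) := ⨅ y : K, Module.End.eigenspace (Matrix.toLin' ((f y).map (algebraMap ℚ ℂ))) (σ y)
    with hWdef
  have hW3 : finrank ℂ W = 3 := by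
    have h := finrank_iInf_eigenspace_toLin'_map_mul_finrank f σ
    rw [← hWdef, hK, hcard] at h
    omega
  -- `𝔤 ⊆ 𝔩𝔣_ℂ`; `W` is `𝔤`-stable
  have hsub : ∀ Z : hodgeGroupComplexLie Φ, (Z : Matrix ι ι ℂ) ∈ lefschetzLieC Φ G := fun Z ↦
    hη.hodgeGroupLieC_subset_lefschetzLieC hGη ((mem_hodgeGroupComplexLie_iff_mem_hodgeGroupLieC Φ).1 Z.2)
  have hstab : ∀ Z : hodgeGroupComplexLie Φ, ∀ u ∈ W, Matrix.toLin' (Z : Matrix ι ι ℂ) u ∈ W := fun Z ↦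
    toLin'_apply_mem_iInf_eigenspace_algHom_of_mem_lefschetzLieC f hfE' σ (hsub Z)
  -- the restriction `ρ : 𝔤 → 𝔤𝔩(W)`
  letI : LieRing (Module.End ℂ W) := LieRing.ofAssociativeRing
  letI : LieAlgebra ℂ (Module.End ℂ W) := LieAlgebra.ofAssociativeAlgebra
  obtain ⟨ρ, hρ⟩ : ∃ ρ : hodgeGroupComplexLie Φ →ₗ⁅ℂ⁆ Module.End ℂ W,
      ∀ (Z : hodgeGroupComplexLie Φ) (w : W), ((ρ Z w : W) : ι → ℂ) = (Z : Matrix ι ι ℂ) *ᵥ (w : ι → ℂ) :=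
    ⟨{ toFun := fun Z ↦ (Matrix.toLin' (Z : Matrix ι ι ℂ)).restrict (hstab Z),
       map_add' := fun Z Z' ↦ by
         apply LinearMap.ext
         intro w
         apply Subtype.ext
         simp only [LinearMap.coe_restrict_apply, LinearMap.add_apply, Submodule.coe_add]
         rw [show ((Z + Z' : hodgeGroupComplexLie Φ) : Matrix ι ι ℂ) = Z + Z' from rfl, map_add, LinearMap.add_apply],
       map_smul' := fun c Z ↦ by
         apply LinearMap.ext
         intro w
         apply Subtype.ext
         simp only [LinearMap.coe_restrict_apply, RingHom.id_apply, LinearMap.smul_apply, Submodule.coe_smul]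
         rw [show ((c • Z : hodgeGroupComplexLie Φ) : Matrix ι ι ℂ) = c • (Z : Matrix ι ι ℂ) from rfl, map_smul,
           LinearMap.smul_apply],
       map_lie' := fun {Z Z'} ↦ by
         apply LinearMap.ext
         intro w
         apply Subtype.ext
         rw [LieRing.of_associative_ring_bracket, LinearMap.sub_apply, Submodule.coe_sub, Module.End.mul_apply,
           Module.End.mul_apply, LinearMap.coe_restrict_apply, LinearMap.coe_restrict_apply, LinearMap.coe_restrict_apply,
           LinearMap.coe_restrict_apply, LinearMap.coe_restrict_apply, LieSubalgebra.coe_bracket,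
           LieRing.of_associative_ring_bracket]
         simp only [Matrix.toLin'_apply, Matrix.sub_mulVec, Matrix.mulVec_mulVec] },
      fun Z w ↦ by
        change (((Matrix.toLin' (Z : Matrix ι ι ℂ)).restrict (hstab Z) w : W) : ι → ℂ) = _
        rw [LinearMap.coe_restrict_apply, Matrix.toLin'_apply]⟩
  -- `ρ` is injective: `Z ∈ 𝔤 ⊆ 𝔩𝔣_ℂ` killing `V_σ` kills `V_σ̄`, hence `V_ℂ`
  have hinj : Injective ρ := by
    rw [← LieHom.ker_eq_bot, LieSubmodule.eq_bot_iff]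
    intro Z hZ
    rw [LieHom.mem_ker] at hZ
    have hD0 : ∀ v ∈ W, (Z : Matrix ι ι ℂ) *ᵥ v = 0 := fun v hv ↦ by
      have h := hρ Z ⟨v, hv⟩
      rw [hZ, LinearMap.zero_apply, Submodule.coe_zero] at h
      exact h.symm
    have hDlf : (Z : Matrix ι ι ℂ) ∈ lefschetzLieC Φ G := hsub Z
    have hDW : ∀ u ∈ ⨅ a : K, Module.End.eigenspace (Matrix.toLin' ((f a).map (algebraMap ℚ ℂ)))
        (ComplexEmbedding.conjugate σ a),
        (Z : Matrix ι ι ℂ) *ᵥ u ∈ ⨅ a : K, Module.End.eigenspace (Matrix.toLin' ((f a).map (algebraMap ℚ ℂ)))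
          (ComplexEmbedding.conjugate σ a) := fun u hu ↦ by
      have h := toLin'_apply_mem_iInf_eigenspace_algHom_of_mem_lefschetzLieC f hfE' (ComplexEmbedding.conjugate σ) hDlf u hu
      rwa [Matrix.toLin'_apply] at h
    have hD0' : ∀ w ∈ ⨅ a : K, Module.End.eigenspace (Matrix.toLin' ((f a).map (algebraMap ℚ ℂ)))
        (ComplexEmbedding.conjugate σ a), (Z : Matrix ι ι ℂ) *ᵥ w = 0 := fun w hw ↦
      mulVec_eq_zero_of_forall_mulVec_eq_zero_of_mem_iInf_eigenspace_conjugate f hGu.ne_zero hsym hσ hsup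
        ((mem_lefschetzLieC_iff Φ).1 hDlf).1 hDW hD0 hw
    have hDall : ∀ v : ι → ℂ, (Z : Matrix ι ι ℂ) *ᵥ v = 0 := fun v ↦ by
      have hv : v ∈ W ⊔ (⨅ a : K, Module.End.eigenspace (Matrix.toLin' ((f a).map (algebraMap ℚ ℂ)))
          (ComplexEmbedding.conjugate σ a)) := by
        rw [hWdef, hsup]; exact Submodule.mem_top
      obtain ⟨y, hy, z, hz, rfl⟩ := Submodule.mem_sup.1 hv
      rw [Matrix.mulVec_add, hD0 y hy, hD0' z hz, add_zero]
    have hZ0 : (Z : Matrix ι ι ℂ) = 0 := Matrix.toLin'.injective (LinearMap.ext fun v ↦ by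
      rw [Matrix.toLin'_apply, hDall v, map_zero, LinearMap.zero_apply])
    exact Subtype.ext hZ0
  -- `ρ` is surjective: `𝔤|V_σ = 𝔤𝔩(V_σ)` (g50-#6)
  have hsurj : Surjective ρ := fun Y ↦ by
    obtain ⟨Z, hZ, hZY⟩ :=
      hX.exists_mem_hodgeGroupLieC_forall_mulVec_eq_of_finrank_eq_two_of_finrank_eq_three hη hK hE f hfE σ hWdef Y
    refine ⟨⟨Z, (mem_hodgeGroupComplexLie_iff_mem_hodgeGroupLieC Φ).2 hZ⟩, LinearMap.ext fun w ↦ Subtype.ext ?_⟩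
    rw [hρ, hZY w]
  -- `𝔤 ≅ 𝔤𝔩(W) ≅ M₃(ℂ)`, so `𝒟𝔤 ≅ 𝒟 M₃(ℂ)` is simple (Jacobson X §3 Thm. 8)
  letI : LieRing (Matrix (Fin 3) (Fin 3) ℂ) := LieRing.ofAssociativeRing
  letI : LieAlgebra ℂ (Matrix (Fin 3) (Fin 3) ℂ) := LieAlgebra.ofAssociativeAlgebra
  haveI : FiniteDimensional ℂ W := inferInstance
  have e : hodgeGroupComplexLie Φ ≃ₗ⁅ℂ⁆ Matrix (Fin 3) (Fin 3) ℂ :=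
    (LieEquiv.ofBijective ρ ⟨hinj, hsurj⟩).trans (algEquivMatrix (finBasisOfFinrankEq ℂ W hW3)).toLieEquiv
  have h9 : finrank ℂ (Matrix (Fin 3) (Fin 3) ℂ) ≠ 1 := by
    rw [Module.finrank_matrix, Fintype.card_fin]
    norm_num
  haveI : LieAlgebra.IsSimple ℂ (derivedSeries ℂ (Matrix (Fin 3) (Fin 3) ℂ) 1) :=
    CentralSimpleDerivedLieAlgebra.isSimple_derived ℂ (Matrix (Fin 3) (Fin 3) ℂ) h9
  exact isSimple_derivedSeries_of_lieEquiv₅₇ e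

/-- **`𝒟𝒜(T)` IS `ℚ`-SIMPLE** for a simple polarised threefold with `End⁰(T) = f(K)`, `K` an imaginary quadratic (CM, degree
`2`) field — a `ℚ`-form of `𝔰𝔩₃` («`𝔥𝔤(X)` … `ℚ`-simple» as used in Lemma (3.4); Bourbaki descent from `𝒟𝔤 ≅ 𝔰𝔩₃`).
[cite: MoonenZarhin1999LowDim, §2 (2.3) Type IV(1,1) and §3 Lemma (3.4)] [cite: Bourbaki1989LieGroups13, Ch. I §6 no. 10] -/
theorem IsSimple.isSimple_derivedSeries_hodgeGroupLieRat_of_finrank_eq_two_of_finrank_eq_three (hX : IsSimple Φ)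
    (hη : IsRiemannForm Φ η) (hK : finrank ℚ K = 2) (hE : finrank ℂ E = 3) (f : K →ₐ[ℚ] Matrix ι ι ℚ)
    (hfE : f.range = endAlgRat Φ) : LieAlgebra.IsSimple ℚ (derivedSeries ℚ (hodgeGroupLieRat Φ) 1) := by
  haveI := hX.isSimple_derivedSeries_hodgeGroupComplexLie_of_finrank_eq_two_of_finrank_eq_three hη hK hE f hfE
  exact isSimple_derivedSeries_hodgeGroupLieRat_of_hodgeGroupComplexLie Φ

end Derived

section Intrinsic

variable {κ : Type} [Fintype κ] [DecidableEq κ] [Nonempty κ] {E : Type} [NormedAddCommGroup E] [NormedSpace ℂ E]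
  [FiniteDimensional ℂ E] {Ψ : (κ → ℝ) ≃L[ℝ] E} {η : E [⋀^Fin 2]→L[ℝ] ℝ}

/-- **TYPE IV(1,1), INTRINSIC FORM: `[Z(End⁰ T) : ℚ] = 2` ⟹ `𝒟𝒜(T)` is `ℚ`-simple** (for a simple threefold
`End⁰(T) = F` is its centre, a CM field iff `e` is even). [cite: MoonenZarhin1999LowDim, §2 (2.3) `g = 3` (p0005 L83–L106)] -/
theorem IsSimple.isSimple_derivedSeries_hodgeGroupLieRat_of_finrank_centerField_eq_two_of_finrank_eq_three (hX : IsSimple Ψ)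
    (hη : IsRiemannForm Ψ η) (h3 : finrank ℂ E = 3) (he : finrank ℚ (centerField Ψ hX) = 2) :
    LieAlgebra.IsSimple ℚ (derivedSeries ℚ (hodgeGroupLieRat Ψ) 1) := by
  haveI : IsCMField (centerField Ψ hX) := (hX.isCMField_centerField_iff_even_of_finrank_eq_three hη h3).2 (by rw [he]; decide)
  exact hX.isSimple_derivedSeries_hodgeGroupLieRat_of_finrank_eq_two_of_finrank_eq_three hη he h3
    (centerField.valAlgHom Ψ hX) (hX.range_valAlgHom_eq_endAlgRat_of_finrank_eq_three h3)

/-- **`dim_ℚ 𝒟𝒜(T) ≥ 8` for `T` of type IV(1,1)** (`dim_ℚ 𝒜(T) = dim Hg(T) = 9`, `𝒜 = 𝔷 ⊕ 𝒟𝒜`, `dim 𝔷(𝒜(T)) < [End⁰(T) : ℚ] = 2`;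
in fact `= 8 = dim 𝔰𝔲(2,1)`). [cite: MoonenZarhin1999LowDim, §2 (2.3) Type IV(1,1) and proof of (2.4)(1)] [cite: Bourbaki1989LieGroups13, Ch. I §6 no. 4 Prop. 5] -/
theorem IsSimple.le_finrank_derivedSeries_hodgeGroupLieRat_of_finrank_centerField_eq_two_of_finrank_eq_three (hX : IsSimple Ψ)
    (hη : IsRiemannForm Ψ η) (h3 : finrank ℂ E = 3) (he : finrank ℚ (centerField Ψ hX) = 2) :
    8 ≤ finrank ℚ (derivedSeries ℚ (hodgeGroupLieRat Ψ) 1) := by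
  haveI : IsCMField (centerField Ψ hX) := (hX.isCMField_centerField_iff_even_of_finrank_eq_three hη h3).2 (by rw [he]; decide)
  have h9 : finrank ℚ (hodgeGroupLieRat Ψ) = 9 := by
    rw [finrank_hodgeGroupLieRat_eq]
    exact hX.finrank_hodgeGroupLie_eq_nine_of_finrank_centerField_eq_two_of_finrank_eq_three hη he h3
  have hz : finrank ℚ (LieAlgebra.center ℚ (hodgeGroupLieRat Ψ)) < 2 :=
    lt_of_lt_of_eq (finrank_center_hodgeGroupLieRat_lt_finrank_endAlgRat Ψ)
      (hX.finrank_endAlgRat_eq_two_of_finrank_centerField_eq_two_of_finrank_eq_three h3 he)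
  have hsum := hη.finrank_center_add_finrank_derived_hodgeGroupLieRat
  omega

end Intrinsic

/-! ## §2 Lemma (3.4) applied: `T` of type IV(1,1) splits off every polarised `S` with `𝒜(S)` `ℚ`-simple of dimension `< 8` -/

section SplitOff

variable {ι : Type*} [Fintype ι] [DecidableEq ι] {F : Type*} [NormedAddCommGroup F] [NormedSpace ℂ F]
  {Φ : (ι → ℝ) ≃L[ℝ] F} {ω : F [⋀^Fin 2]→L[ℝ] ℝ}
  {κ : Type} [Fintype κ] [DecidableEq κ] [Nonempty κ] {E : Type} [NormedAddCommGroup E] [NormedSpace ℂ E]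
  [FiniteDimensional ℂ E] {Ψ : (κ → ℝ) ≃L[ℝ] E} {η : E [⋀^Fin 2]→L[ℝ] ℝ}

/-- **MOONEN–ZARHIN LEMMA (3.4) FOR `T` OF TYPE IV(1,1)**: `T` a simple polarised threefold with `[Z(End⁰ T) : ℚ] = 2`, `S` a
polarised complex torus whose Hodge Lie algebra `𝒜(S)` is `ℚ`-SIMPLE of dimension `< 8` ⟹ `Hg(T × S)(ℂ) = Hg(T)(ℂ) × Hg(S)(ℂ)`
— otherwise `𝒜(S)` would be abelian, or a quotient of the simple `𝒟𝒜(T)` («an isomorphism `𝔥𝔤(X₂) ⥲ 𝔤₃`»), of dimension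
`≥ 8`. [cite: MoonenZarhin1999LowDim, §3 Lemma (3.4) and its proof (p0006 L133 – p0007 L8), §5 (5.8) (p0010 L3–L9)]
[cite: Gordon1997, §2.16 Proposition] [cite: Bourbaki1989LieGroups13, Ch. I §1 no. 5 Prop. 4] -/
theorem IsSimple.hodgeGroupC_prod_eq_blockDiagProd_of_finrank_centerField_eq_two_of_isSimple_hodgeGroupLieRat_of_finrank_lt
    (hT : IsSimple Ψ) (hη : IsRiemannForm Ψ η) (h3 : finrank ℂ E = 3) (he : finrank ℚ (centerField Ψ hT) = 2)
    (hω : IsRiemannForm Φ ω) [LieAlgebra.IsSimple ℚ (hodgeGroupLieRat Φ)] (hlt : finrank ℚ (hodgeGroupLieRat Φ) < 8) :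
    hodgeGroupC (prodPeriod Ψ Φ) = blockDiagProd (hodgeGroupC Ψ) (hodgeGroupC Φ) := by
  by_contra hne
  rcases hη.isLieAbelian_and_exists_injective_or_isSemisimple_and_exists_surjective_of_ne_of_almostQSimple
      (forall_eq_bot_or_eq_of_isSimple_hodgeGroupLieRat Φ) hω hne with ⟨hab, -⟩ | ⟨-, ψ, hψ⟩
  · exact LieAlgebra.IsSimple.non_abelian ℚ (L := hodgeGroupLieRat Φ) hab
  · haveI := hT.isSimple_derivedSeries_hodgeGroupLieRat_of_finrank_centerField_eq_two_of_finrank_eq_three hη h3 he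
    have h8 := hT.le_finrank_derivedSeries_hodgeGroupLieRat_of_finrank_centerField_eq_two_of_finrank_eq_three hη h3 he
    rcases LieAlgebra.IsSimple.eq_bot_or_eq_top (LieHom.ker ψ) with hk | hk
    · -- `ψ` is an isomorphism: `dim 𝒜(S) = dim 𝒟𝒜(T) ≥ 8`
      have hinj : Injective ψ := (LieHom.ker_eq_bot ψ).1 hk
      have heq := (LinearEquiv.ofBijective (ψ : derivedSeries ℚ (hodgeGroupLieRat Ψ) 1 →ₗ[ℚ] hodgeGroupLieRat Φ)
        ⟨hinj, hψ⟩).finrank_eq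
      omega
    · -- `ψ = 0`: `𝒜(S) = 0` would be abelian
      have h0 : ∀ y : hodgeGroupLieRat Φ, y = 0 := fun y ↦ by
        obtain ⟨x, rfl⟩ := hψ y
        have hx : x ∈ LieHom.ker ψ := by rw [hk]; exact LieSubmodule.mem_top x
        exact (LieHom.mem_ker.1 hx)
      haveI : IsLieAbelian (hodgeGroupLieRat Φ) := ⟨fun x m ↦ h0 _⟩
      exact LieAlgebra.IsSimple.non_abelian ℚ (L := hodgeGroupLieRat Φ) inferInstance

/-- Real points: `Hg(T × S)(ℝ) = Hg(T)(ℝ) × Hg(S)(ℝ)` under the same hypotheses. [cite: MoonenZarhin1999LowDim, §3 Lemma (3.4) and §5 (5.8)] -/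
theorem IsSimple.hodgeGroup_prod_eq_of_finrank_centerField_eq_two_of_isSimple_hodgeGroupLieRat_of_finrank_lt
    (hT : IsSimple Ψ) (hη : IsRiemannForm Ψ η) (h3 : finrank ℂ E = 3) (he : finrank ℚ (centerField Ψ hT) = 2)
    (hω : IsRiemannForm Φ ω) [LieAlgebra.IsSimple ℚ (hodgeGroupLieRat Φ)] (hlt : finrank ℚ (hodgeGroupLieRat Φ) < 8) :
    hodgeGroup (prodPeriod Ψ Φ) = ((hodgeGroup Ψ).prod (hodgeGroup Φ)).map (blockDiag κ ι) :=
  hodgeGroup_prod_eq_of_hodgeGroupC_prod_eq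
    (hT.hodgeGroupC_prod_eq_blockDiagProd_of_finrank_centerField_eq_two_of_isSimple_hodgeGroupLieRat_of_finrank_lt hη h3 he hω hlt)

/-- **(D)-transfer: `T` of type IV(1,1), `S` polarised and stably nondegenerate with `𝒜(S)` `ℚ`-simple of dimension `< 8` ⟹
`T × S` satisfies (D)** (`T` is stably nondegenerate: every abelian threefold is).
[cite: MoonenZarhin1999LowDim, Thm. (0.2) (4) (p0002 L1–L8), §5 (5.8), §3 Thm. (3.2) (2)] [cite: Hazama1983, Lemma (3.1)] -/
theorem IsSimple.forall_divisorClasses_powPeriod_prod_eq_hodgeClasses_of_finrank_centerField_eq_two_of_isSimple_hodgeGroupLieRat_of_finrank_lt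
    (hT : IsSimple Ψ) (hη : IsRiemannForm Ψ η) (h3 : finrank ℂ E = 3) (he : finrank ℚ (centerField Ψ hT) = 2)
    (hω : IsRiemannForm Φ ω) [LieAlgebra.IsSimple ℚ (hodgeGroupLieRat Φ)] (hlt : finrank ℚ (hodgeGroupLieRat Φ) < 8)
    (hS : ∀ k p, divisorClasses (powPeriod Φ k) p = hodgeClasses (powPeriod Φ k) p) :
    ∀ k p, divisorClasses (powPeriod (prodPeriod Ψ Φ) k) p = hodgeClasses (powPeriod (prodPeriod Ψ Φ) k) p :=
  forall_divisorClasses_powPeriod_prod_eq_hodgeClasses_of_hodgeGroupC_prod_eq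
    (hT.hodgeGroupC_prod_eq_blockDiagProd_of_finrank_centerField_eq_two_of_isSimple_hodgeGroupLieRat_of_finrank_lt hη h3 he hω hlt)
    (hη.forall_divisorClasses_powPeriod_eq_hodgeClasses_of_finrank_eq_three h3) hS

end SplitOff

end ComplexTorus

end Literature.Geometry.Kaehler
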